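import Mathlib
import Literature.Analysis.FluidPDE.SelfSimilarEulerProfile
import Literature.Analysis.FluidPDE.SelfSimilarEulerOutgoingExclusionTools
import Literature.NumberTheory.LFunctions.NicolasMertensRHProofs
import Summits.NavierStokesRegularity.NavierStokesRegularity.Theorems.EulerZoomLiouvillePowerGaugeEulerLiouvilleChannelClockTools
import Summits.NavierStokesRegularity.NavierStokesRegularity.Theorems.EulerZoomLiouvillePowerGaugeEulerLiouvilleDriftClockShellTools
import Summits.NavierStokesRegularity.NavierStokesRegularity.Theorems.EulerZoomLiouvillePowerGaugeEulerLiouvilleSelfSimilarVorticalEscape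
import Summits.NavierStokesRegularity.NavierStokesRegularity.Theorems.EulerZoomLiouvillePowerGaugeEulerLiouvilleOutflowDiveVorticityTransport
import HarnessLib

/-!
# «ANY INWARD DRIFT KILLS», IV (class-free): the absolute inflow-band deficit with a DECAYING FLOOR `a₀/‖y‖²` is still a POWER RESIDENCE CLOCK
# (crux `EulerZoomLiouville.PowerGaugeEulerLiouville` = stmt-NavierStokesRegularity-19832, THE ONE STATEMENT `stub_selfSimilarC2Needle`; binder `HasFastVorticalChannel` alt 7)

Route `EulerZoomLiouville` (NavierStokesRegularity), crux E, LEAD seat ns-typeII-p2 g13 (own brick, sequel of `…DriftClock`).  Same setting and notation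
(`W y = γy + V y`, `γ = 1/(2+ρ)`, `ℛ = ⟪y, W y⟫`, `a(y) = ‖W y‖² + γℛ + ⟪y, DV(y)(W y)⟫ = Dℛ(y)[W y]`).  DECAYING-FLOOR ABSOLUTE BAND DEFICIT (for this pressure): ONE
width `κb > 0` and ONE constant `a₀ > 0` such that for every level `h`, beyond some radius, every vortical point of `{ℋ > h}` with `−κb ≤ ℛ(y) ≤ 0` has
`a(y) ≥ a₀/‖y‖²`.  On the lingering window `‖·‖ ≤ 2R` the floor is uniformly `≥ a₀/(4R²)`, so the band is crossed in time `8κbR²/a₀` and the square-root escape takes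
`≈ 2R²/κb` — both `≪ c′R^{2+ρ}` because `ρ > 0`.

* `DriftClock.powerClock_of_decayingBandDeficit` — the deficit yields VERBATIM the `hclock` hypothesis of `NeedleRace.selfSimilar_ae_eq_zero_of_subcriticalClockC2`
  (POWER clock, every `c′ > 0`).  ⊇ `DriftClock.powerClock_of_absBandDeficit` (constant floor).

Mechanism: as in `…DriftClock` with `DriftClock.abs_band_bootstrap_shell` (deficit used only on `R₁ ≤ ‖y‖ ≤ 2R`, where the lingering arc lives).
Residue for THE ONE STATEMENT (sequel `…DriftClockDecayMember`, alternative 7): for all `κb, a₀ > 0` the needle has, beyond every radius, vortical Bernoulli-high points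
CIRCULAR TO ORDER `1/‖y‖` (`−κb ≤ ℛ ≤ 0`) and CENTRIPETALLY BALANCED TO ORDER `1/‖y‖²` (`a < a₀/‖y‖²`): h-free, `y·∇P′ > ‖W‖² + γ(1−γ)‖y‖² − a₀/‖y‖² − (1−2γ)κb`.

WHAT THIS IS NOT: not NS, not E — a class-free ODE/measure lemma about `C²` profiles (no budgets), `--supports` stmt-19832; the crux is OPEN;
NS regularity is NOT proved. [folklore; cf. ConstantinIgnatovaVicol2026Putative §3.4 (3.19)–(3.22), §3.4.3 (3.31)]
-/
noncomputable section

-- flat `Theorems/<Route><Decl>…` files of one crux share the namespace of the crux (tree convention: `Summit.<S>.<S>.…`)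
set_option linter.dupNamespace false

open Set Filter Topology Metric MeasureTheory
open scoped RealInnerProductSpace ENNReal

namespace Summit.NavierStokesRegularity.NavierStokesRegularity.Theorems.PowerGaugeEulerLiouville

open Literature.Analysis Literature.Analysis.FluidPDE

namespace DriftClock

open ChannelClock

/-- **«ANY INWARD DRIFT KILLS» with a DECAYING FLOOR: an absolute inflow-band deficit `a ≥ a₀/‖y‖²` (width `κb > 0`) is a POWER RESIDENCE CLOCK**
(conclusion = the `hclock` hypothesis of `NeedleRace.selfSimilar_ae_eq_zero_of_subcriticalClockC2`, for every `c′ > 0`). [folklore; cf. ConstantinIgnatovaVicol2026Putative §3.4–§3.5] -/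
theorem powerClock_of_decayingBandDeficit {ρ : ℝ} (hρ : 0 < ρ) (hρh : ρ ≤ 1 / 2)
    {V : EuclideanSpace ℝ (Fin 3) → EuclideanSpace ℝ (Fin 3)} {P' : EuclideanSpace ℝ (Fin 3) → ℝ}
    (hprof : IsSelfSimilarEulerProfile (1 / (2 + ρ)) 0 V P') {κb a₀ : ℝ} (hκb : 0 < κb) (ha₀ : 0 < a₀)
    (hdef : ∀ h : ℝ, ∃ R₀ : ℝ, ∀ y : EuclideanSpace ℝ (Fin 3), R₀ ≤ ‖y‖ →
      h < selfSimilarBernoulli (1 / (2 + ρ)) 0 V P' y → curl V y ≠ 0 →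
        -κb ≤ ⟪y, selfSimilarTransport (1 / (2 + ρ)) 0 V y⟫ → ⟪y, selfSimilarTransport (1 / (2 + ρ)) 0 V y⟫ ≤ 0 →
        a₀ / ‖y‖ ^ 2 ≤ ‖selfSimilarTransport (1 / (2 + ρ)) 0 V y‖ ^ 2 +
          (1 / (2 + ρ)) * ⟪y, selfSimilarTransport (1 / (2 + ρ)) 0 V y⟫ +
          ⟪y, fderiv ℝ V y (selfSimilarTransport (1 / (2 + ρ)) 0 V y)⟫) :
    ∀ c' : ℝ, 0 < c' → ∀ x₀ : EuclideanSpace ℝ (Fin 3), curl V x₀ ≠ 0 → ∃ r : ℝ, 0 < r ∧ ∃ R₀ : ℝ,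
      ∀ R : ℝ, R₀ ≤ R → ∀ (V' : EuclideanSpace ℝ (Fin 3) → EuclideanSpace ℝ (Fin 3)) (K Rbig : ℝ), ContDiff ℝ 2 V' →
        (∀ y, ‖fderiv ℝ V' y‖ ≤ K) → 2 * R < Rbig →
        (∀ w ∈ ball (0 : EuclideanSpace ℝ (Fin 3)) Rbig, V' w = V w) →
        (volume (ball x₀ r ∩ {y | ∀ σ ∈ Icc 0 (c' * R ^ (2 + ρ)),
          ‖ODE.evolutionMap (fun _ : ℝ => selfSimilarTransport (1 / (2 + ρ)) 0 V') 0 (-σ) y‖ ≤ 2 * R})).toReal ≤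
          (volume (ball x₀ r)).toReal / 2 := by
  intro c' hc' x₀ hx₀
  set γ : ℝ := 1 / (2 + ρ) with hγdef
  have h2ρ : (0 : ℝ) < 2 + ρ := by linarith
  have hγ : 0 < γ := one_div_pos.2 h2ρ
  have hγ2 : γ < 1 / 2 := one_div_lt_one_div_of_lt two_pos (by linarith)
  have hU2 : ContDiff ℝ 2 V := hprof.contDiff_velocity
  -- ### the blob: a small ball inside `{ℋ > h} ∩ {curl ≠ 0}`, `h = ℋ(x₀) − 1`
  set h : ℝ := selfSimilarBernoulli γ 0 V P' x₀ - 1 with hhdef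
  have hHc : Continuous (selfSimilarBernoulli γ 0 V P') := hprof.contDiff_selfSimilarBernoulli.continuous
  have hcurlc : Continuous (curl V) := (differentiable_curl_of_contDiff hU2).continuous
  have hOopen : IsOpen {y : EuclideanSpace ℝ (Fin 3) | h < selfSimilarBernoulli γ 0 V P' y ∧ curl V y ≠ 0} := by
    rw [setOf_and]
    exact (isOpen_lt continuous_const hHc).inter (isOpen_ne_fun hcurlc continuous_const)
  have hx₀O : x₀ ∈ {y : EuclideanSpace ℝ (Fin 3) | h < selfSimilarBernoulli γ 0 V P' y ∧ curl V y ≠ 0} :=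
    ⟨by rw [hhdef]; linarith, hx₀⟩
  obtain ⟨r₀, hr₀, hball₀⟩ := Metric.isOpen_iff.1 hOopen x₀ hx₀O
  set r : ℝ := min r₀ 1 with hrdef
  have hr : 0 < r := lt_min hr₀ one_pos
  have hr1 : r ≤ 1 := min_le_right _ _
  have hballO : ∀ y ∈ ball x₀ r, h < selfSimilarBernoulli γ 0 V P' y ∧ curl V y ≠ 0 :=
    fun y hy => hball₀ (ball_subset_ball (min_le_left _ _) hy)
  -- ### the far threshold `R₁` of the channel at level `h`, and the hitting radius `R_* ≥ 2R₁`
  obtain ⟨R₁', hR₁'⟩ := hdef h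
  set R₁ : ℝ := max R₁' 1 with hR₁def
  have hR₁pos : 0 < R₁ := lt_of_lt_of_le one_pos (le_max_right _ _)
  have hfar : ∀ y : EuclideanSpace ℝ (Fin 3), R₁ ≤ ‖y‖ → h < selfSimilarBernoulli γ 0 V P' y → curl V y ≠ 0 →
      -κb ≤ ⟪y, selfSimilarTransport γ 0 V y⟫ → ⟪y, selfSimilarTransport γ 0 V y⟫ ≤ 0 →
      a₀ / ‖y‖ ^ 2 ≤ ‖selfSimilarTransport γ 0 V y‖ ^ 2 + γ * ⟪y, selfSimilarTransport γ 0 V y⟫ +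
        ⟪y, fderiv ℝ V y (selfSimilarTransport γ 0 V y)⟫ :=
    fun y hy hh hc hlo hhi => hR₁' y (le_trans (le_max_left _ _) hy) hh hc hlo hhi
  set Rs : ℝ := max (2 * R₁) (‖x₀‖ + 2) with hRsdef
  have hRs2R₁ : 2 * R₁ ≤ Rs := le_max_left _ _
  have hR₁1 : 1 ≤ R₁ := le_max_right _ _
  have hRs1 : 1 ≤ Rs := le_trans (by linarith) hRs2R₁
  have hRspos : 0 < Rs := by linarith
  have hballRs : ∀ y ∈ ball x₀ r, ‖y‖ < Rs - 1 := by
    intro y hy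
    have h1 : dist y x₀ < r := mem_ball.1 hy
    have h2 : ‖y‖ ≤ dist y x₀ + ‖x₀‖ := by
      have := dist_triangle y x₀ 0
      rwa [dist_zero_right, dist_zero_right] at this
    linarith [le_max_right (2 * R₁) (‖x₀‖ + 2)]
  -- ### the R-independent cut-off orbit and the near-confinement sets
  obtain ⟨V₀, hV₀, -, -, ⟨K₀, hK₀⟩, hagree₀⟩ := Loc.exists_cutoff_local hU2 (R := Rs + 1) (by linarith)
  have hV₀1 : ContDiff ℝ 1 V₀ := hV₀.of_le (by norm_num)
  have hW₀eq : ∀ z : EuclideanSpace ℝ (Fin 3), ‖z‖ < Rs + 1 → selfSimilarTransport γ 0 V₀ z = selfSimilarTransport γ 0 V z := by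
    intro z hz
    simp only [selfSimilarTransport_apply, hagree₀ z (by rwa [mem_ball, dist_zero_right])]
  set Φ₀ := ODE.evolutionMap (fun _ : ℝ => selfSimilarTransport γ 0 V₀) 0 with hΦ₀
  set Sn : ℕ → Set (EuclideanSpace ℝ (Fin 3)) := fun n =>
    ball x₀ r ∩ {y | ∀ σ ∈ Icc (0 : ℝ) n, ‖Φ₀ (-σ) y‖ ≤ Rs} with hSndef
  have hSn_meas : ∀ n, MeasurableSet (Sn n) := by
    intro n
    refine measurableSet_ball.inter (IsClosed.measurableSet ?_)
    have : {y : EuclideanSpace ℝ (Fin 3) | ∀ σ ∈ Icc (0 : ℝ) n, ‖Φ₀ (-σ) y‖ ≤ Rs} =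
        ⋂ σ ∈ Icc (0 : ℝ) n, {y | ‖Φ₀ (-σ) y‖ ≤ Rs} := by ext y; simp
    rw [this]
    refine isClosed_biInter fun σ _ => ?_
    exact isClosed_le ((C2.Kelvin.contDiff_flow (γ := γ) hV₀ hK₀ (-σ)).continuous.norm) continuous_const
  have hSn_anti : Antitone Sn := by
    intro m n hmn y hy
    refine ⟨hy.1, fun σ hσ => hy.2 σ ⟨hσ.1, le_trans hσ.2 (by exact_mod_cast hmn)⟩⟩
  -- the intersection is inside the confined vortical set, null by W3b
  have hInter_null : volume (⋂ n, Sn n) = 0 := by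
    refine measure_mono_null ?_ (Loc.volume_vortical_confined_eq_zero hprof hγ hγ2 hRspos)
    intro y hy
    rw [mem_iInter] at hy
    have hy0 : y ∈ ball x₀ r := (hy 0).1
    refine ⟨(hballO y hy0).2, fun t => Φ₀ (-t) y, by simp [hΦ₀, ODE.evolutionMap_self], ?_, ?_⟩
    · intro t ht
      have hconf : ‖Φ₀ (-t) y‖ ≤ Rs := by
        obtain ⟨n, hn⟩ := exists_nat_ge t
        exact (hy n).2 t ⟨ht, hn⟩
      have hd := C2.Kelvin.hasDerivAt_flow_neg (γ := γ) hV₀1 hK₀ y t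
      rw [hW₀eq _ (by linarith)] at hd
      exact hd
    · intro t ht
      obtain ⟨n, hn⟩ := exists_nat_ge t
      exact (hy n).2 t ⟨ht, hn⟩
  have htend : Tendsto (volume ∘ Sn) atTop (𝓝 0) := by
    rw [← hInter_null]
    exact tendsto_measure_iInter_atTop (fun n => (hSn_meas n).nullMeasurableSet) hSn_anti
      ⟨0, (measure_mono inter_subset_left).trans_lt measure_ball_lt_top |>.ne⟩
  -- choose `n₀` with `volume (Sn n₀) ≤ volume (ball x₀ r) / 2`
  have hvpos : 0 < volume (ball x₀ r) := measure_ball_pos volume x₀ hr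
  have hvtop : volume (ball x₀ r) < ∞ := measure_ball_lt_top
  have hhalf_pos : (0 : ℝ≥0∞) < volume (ball x₀ r) / 2 := ENNReal.half_pos hvpos.ne'
  obtain ⟨n₀, hn₀⟩ := (htend.eventually (ge_mem_nhds hhalf_pos)).exists
  -- ### the clock radius
  set B : ℝ := ((n₀ : ℝ) + 1 + 8 * κb / a₀ + 3 / κb) / c' with hBdef
  have hBpos : 0 < B := by positivity
  refine ⟨r, hr, max Rs (B ^ ρ⁻¹), fun R hR V' K Rbig hV' hK' hRbig hagree' => ?_⟩
  have hRRs : Rs ≤ R := le_trans (le_max_left _ _) hR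
  have hR1 : 1 ≤ R := le_trans hRs1 hRRs
  have hRpos : 0 < R := by linarith
  -- `R ^ ρ ≥ B`, hence `c' R^{2+ρ} ≥ R² (n₀ + 1 + 8κb/a₀ + 3/κb)`
  have hRρ : B ≤ R ^ ρ := by
    have h1 : B ^ ρ⁻¹ ≤ R := le_trans (le_max_right _ _) hR
    have h2 := Real.rpow_le_rpow (Real.rpow_nonneg hBpos.le _) h1 hρ.le
    rwa [Real.rpow_inv_rpow hBpos.le hρ.ne'] at h2
  have hn₀_nonneg : (0 : ℝ) ≤ n₀ := Nat.cast_nonneg n₀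
  -- the band transit time at scale `R` and the shell deficit with the uniform floor `a₀/(4R²)`
  set τ : ℝ := 8 * κb * R ^ 2 / a₀ with hτdef
  have hτpos : 0 < τ := by positivity
  set aR : ℝ := a₀ / (4 * R ^ 2) with haRdef
  have haRpos : 0 < aR := by positivity
  have hfarR : ∀ y : EuclideanSpace ℝ (Fin 3), R₁ ≤ ‖y‖ → ‖y‖ ≤ 2 * R → h < selfSimilarBernoulli γ 0 V P' y → curl V y ≠ 0 →
      -κb ≤ ⟪y, selfSimilarTransport γ 0 V y⟫ → ⟪y, selfSimilarTransport γ 0 V y⟫ ≤ 0 →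
      aR ≤ ‖selfSimilarTransport γ 0 V y‖ ^ 2 + γ * ⟪y, selfSimilarTransport γ 0 V y⟫ +
        ⟪y, fderiv ℝ V y (selfSimilarTransport γ 0 V y)⟫ := by
    intro y hy1 hy2 hh hc hlo hhi
    have hdy := hfar y hy1 hh hc hlo hhi
    have hypos : 0 < ‖y‖ := lt_of_lt_of_le hR₁pos hy1
    have hle : aR ≤ a₀ / ‖y‖ ^ 2 := by
      rw [haRdef]
      apply div_le_div_of_nonneg_left ha₀.le (by positivity)
      nlinarith only [hy2, hypos]
    exact hle.trans hdy
  set TR : ℝ := c' * R ^ (2 + ρ) with hTRdef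
  have hTR_ge : (n₀ : ℝ) + τ + 1 + 3 * R ^ 2 / κb ≤ TR := by
    have e : R ^ (2 + ρ) = R ^ 2 * R ^ ρ := by
      rw [Real.rpow_add hRpos, Real.rpow_two]
    rw [hTRdef, e]
    have h1 : c' * (R ^ 2 * B) ≤ c' * (R ^ 2 * R ^ ρ) :=
      mul_le_mul_of_nonneg_left (mul_le_mul_of_nonneg_left hRρ (sq_nonneg _)) hc'.le
    have h2' : ((n₀ : ℝ) + 1 + 8 * κb / a₀ + 3 / κb) / c' * c' = (n₀ : ℝ) + 1 + 8 * κb / a₀ + 3 / κb := div_mul_cancel₀ _ hc'.ne'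
    have h2 : c' * (R ^ 2 * B) = R ^ 2 * ((n₀ : ℝ) + 1 + 8 * κb / a₀ + 3 / κb) := by
      rw [hBdef]
      have : c' * (R ^ 2 * (((n₀ : ℝ) + 1 + 8 * κb / a₀ + 3 / κb) / c')) = R ^ 2 * ((((n₀ : ℝ) + 1 + 8 * κb / a₀ + 3 / κb) / c') * c') := by ring
      rw [this, h2']
    have hR2 : 1 ≤ R ^ 2 := one_le_pow₀ hR1
    have hpos3 : 0 ≤ (n₀ : ℝ) + 1 := by linarith only [hn₀_nonneg]
    have h3 : ((n₀ : ℝ) + 1) + R ^ 2 * (8 * κb / a₀) + R ^ 2 * (3 / κb) ≤ R ^ 2 * ((n₀ : ℝ) + 1 + 8 * κb / a₀ + 3 / κb) := by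
      nlinarith only [hR2, hpos3]
    have h4 : R ^ 2 * (3 / κb) = 3 * R ^ 2 / κb := by
      rw [mul_div_assoc']
      ring
    have h5 : R ^ 2 * (8 * κb / a₀) = τ := by
      rw [hτdef, mul_div_assoc']
      ring
    linarith only [h1, h2, h3, h4, h5]
  -- ### the main inclusion: lingering labels lie in `Sn n₀`
  have hV'1 : ContDiff ℝ 1 V' := hV'.of_le (by norm_num)
  have hW'eq : ∀ z : EuclideanSpace ℝ (Fin 3), ‖z‖ < Rbig → selfSimilarTransport γ 0 V' z = selfSimilarTransport γ 0 V z := by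
    intro z hz
    simp only [selfSimilarTransport_apply, hagree' z (by rwa [mem_ball, dist_zero_right])]
  set Φ' := ODE.evolutionMap (fun _ : ℝ => selfSimilarTransport γ 0 V') 0 with hΦ'
  have hincl : ball x₀ r ∩ {y | ∀ σ ∈ Icc 0 TR, ‖Φ' (-σ) y‖ ≤ 2 * R} ⊆ Sn n₀ := by
    rintro y ⟨hyB, hling⟩
    refine ⟨hyB, ?_⟩
    rw [mem_setOf_eq]
    by_contra hnot
    push Not at hnot
    obtain ⟨σ₀, hσ₀, hfar₀⟩ := hnot
    -- the two orbits
    set Y : ℝ → EuclideanSpace ℝ (Fin 3) := fun t => Φ' (-t) y with hYdef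
    set Y₀ : ℝ → EuclideanSpace ℝ (Fin 3) := fun t => Φ₀ (-t) y with hY₀def
    have hYd : ∀ t, HasDerivAt Y ((-1 : ℝ) • selfSimilarTransport γ 0 V' (Y t)) t :=
      fun t => C2.Kelvin.hasDerivAt_flow_neg (γ := γ) hV'1 hK' y t
    have hY₀d : ∀ t, HasDerivAt Y₀ ((-1 : ℝ) • selfSimilarTransport γ 0 V₀ (Y₀ t)) t :=
      fun t => C2.Kelvin.hasDerivAt_flow_neg (γ := γ) hV₀1 hK₀ y t
    have hYc : Continuous Y := continuous_iff_continuousAt.2 fun t => (hYd t).continuousAt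
    have hY₀c : Continuous Y₀ := continuous_iff_continuousAt.2 fun t => (hY₀d t).continuousAt
    have hY0 : Y 0 = y := by simp [hYdef, hΦ', ODE.evolutionMap_self]
    have hY₀0 : Y₀ 0 = y := by simp [hY₀def, hΦ₀, ODE.evolutionMap_self]
    -- first hit of the sphere `‖·‖ = Rs` by the cut-off orbit, at a time `σ₁ ∈ (0, σ₀]`
    have hy_lt : ‖Y₀ 0‖ < Rs := by rw [hY₀0]; linarith [hballRs y hyB]
    obtain ⟨σ₁, hσ₁pos, hσ₁le, hhit, hinside⟩ :=
      exists_first_hit (f := fun t => ‖Y₀ t‖) hσ₀.1 (hY₀c.norm.continuousOn) hy_lt hfar₀.le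
    have hσ₁n₀ : σ₁ ≤ n₀ := le_trans hσ₁le hσ₀.2
    -- on `[0, σ₁]` the cut-off orbit is a `V'`-orbit; by uniqueness `Y = Y₀` there
    have hRs_lt_Rbig : Rs + 1 ≤ Rbig := by linarith
    have hY₀V' : ∀ t ∈ Icc 0 σ₁, HasDerivAt Y₀ ((-1 : ℝ) • selfSimilarTransport γ 0 V' (Y₀ t)) t := by
      intro t ht
      have hn : ‖Y₀ t‖ ≤ Rs := hinside t ht
      have hd := hY₀d t
      rw [hW₀eq _ (by linarith), ← hW'eq _ (by linarith)] at hd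
      exact hd
    have hL' := C2.Kelvin.lipschitzWith_selfSimilarTransport (γ := γ) hV'1 hK'
    have hLneg : LipschitzWith (Real.toNNReal (|γ| + K)) (fun z => (-1 : ℝ) • selfSimilarTransport γ 0 V' z) :=
      LipschitzWith.of_dist_le_mul fun a b => by
        rw [neg_one_smul, neg_one_smul, dist_neg_neg]
        exact hL'.dist_le_mul a b
    have hEq : EqOn Y₀ Y (Icc 0 σ₁) :=
      ODE_solution_unique (v := fun _ z => (-1 : ℝ) • selfSimilarTransport γ 0 V' z)
        (fun _ => hLneg)
        (hY₀c.continuousOn) (fun t ht => (hY₀V' t (Ico_subset_Icc_self ht)).hasDerivWithinAt)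
        (hYc.continuousOn) (fun t _ => (hYd t).hasDerivWithinAt) (by rw [hY₀0, hY0])
    have hYσ₁ : ‖Y σ₁‖ = Rs := by
      rw [← hEq (right_mem_Icc.2 hσ₁pos.le)]; exact hhit
    -- on `[0, TR]` the `V'`-orbit stays in `B̄(0,2R) ⊆ ball 0 Rbig`: it is a `V`-arc there
    have hTR0 : 0 ≤ TR := by rw [hTRdef]; exact mul_nonneg hc'.le (Real.rpow_nonneg hRpos.le _)
    have hστTR : σ₁ + τ ≤ TR := by
      have : 0 ≤ 3 * R ^ 2 / κb := div_nonneg (by nlinarith only [hRpos]) hκb.le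
      linarith only [hTR_ge, this, hσ₁n₀]
    have hσ₁TR : σ₁ ≤ TR := by linarith only [hστTR, hτpos]
    have hYV : ∀ t ∈ Icc 0 TR, HasDerivAt Y (-(selfSimilarTransport γ 0 V (Y t))) t := by
      intro t ht
      have hn : ‖Y t‖ ≤ 2 * R := hling t ht
      have hd := hYd t
      rw [neg_one_smul, hW'eq _ (by linarith)] at hd
      exact hd
    -- Bernoulli-high and vortical along the whole arc
    have hhighY : ∀ t ∈ Icc 0 TR, h < selfSimilarBernoulli γ 0 V P' (Y t) := by
      intro t ht
      have hmono := bernoulli_le_of_arc hprof hγ2.le ht.1 (fun s hs => hYV s ⟨hs.1, le_trans hs.2 ht.2⟩)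
      rw [hY0] at hmono
      exact lt_of_lt_of_le (hballO y hyB).1 hmono
    have hvortY : ∀ t ∈ Icc 0 TR, curl V (Y t) ≠ 0 := by
      intro t ht
      have h0 : curl V (Y 0) ≠ 0 := by rw [hY0]; exact (hballO y hyB).2
      exact OutflowDive.vorticityTransport ρ hρ hρh V P' hprof t ht.1 Y
        (fun s hs => hYV s ⟨hs.1, le_trans hs.2 ht.2⟩) h0
    -- ### the radial rate at the first hit is `≤ 0`
    have hV1 : ContDiff ℝ 1 V := hU2.of_le (by norm_num)
    have hrate₁ : ⟪Y σ₁, selfSimilarTransport γ 0 V (Y σ₁)⟫ ≤ 0 := by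
      by_contra hpos
      push Not at hpos
      -- `N = ‖Y‖²` has derivative `−2ℛ < 0` at `σ₁`, so it was larger just before: contradiction with `‖Y‖ ≤ Rs` on `[0, σ₁]`
      have hNd : HasDerivAt (fun s => ‖Y s‖ ^ 2) (2 * ⟪Y σ₁, -(selfSimilarTransport γ 0 V (Y σ₁))⟫) σ₁ :=
        (hYV σ₁ ⟨hσ₁pos.le, hσ₁TR⟩).norm_sq
      have hneg : 2 * ⟪Y σ₁, -(selfSimilarTransport γ 0 V (Y σ₁))⟫ < 0 := by
        rw [inner_neg_right]; linarith
      have hev := Literature.NumberTheory.LFunctions.Nicolas.eventually_nhdsLT_lt_of_hasDerivAt_neg hNd hneg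
      have hev2 : ∀ᶠ z in 𝓝[<] σ₁, 0 ≤ z := Filter.eventually_of_mem (Ioo_mem_nhdsLT hσ₁pos) fun z hz => hz.1.le
      obtain ⟨z, ⟨hz, hz0⟩, hzlt⟩ := ((hev.and hev2).and self_mem_nhdsWithin).exists
      have hzle : ‖Y z‖ ≤ Rs := by
        rw [← hEq ⟨hz0, (le_of_lt hzlt)⟩]; exact hinside z ⟨hz0, le_of_lt hzlt⟩
      have h1 : ‖Y z‖ ^ 2 ≤ Rs ^ 2 := pow_le_pow_left₀ (norm_nonneg _) hzle 2
      rw [hYσ₁] at hz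
      linarith
    -- ### phase 1: crossing the band on `[σ₁, σ₁ + τ]` — the radial rate sinks to `≤ −κb`
    have hsub1 : Icc σ₁ (σ₁ + τ) ⊆ Icc 0 TR := fun s hs => ⟨le_trans hσ₁pos.le hs.1, le_trans hs.2 hστTR⟩
    have hR₁Rs : R₁ ≤ Rs := by linarith
    have hτa : aR * τ = 2 * κb := by
      rw [haRdef, hτdef]
      have hR2pos : 0 < R ^ 2 := by positivity
      field_simp
      ring
    have hmk : (0 : ℝ) + aR / 2 * (σ₁ + τ - σ₁) = κb := by
      have : aR / 2 * (σ₁ + τ - σ₁) = aR * τ / 2 := by ring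
      rw [this, hτa]; ring
    have hYσ₁' : R₁ ≤ ‖Y σ₁‖ := by rw [hYσ₁]; exact hR₁Rs
    have hrate₁' : ⟪Y σ₁, selfSimilarTransport γ 0 V (Y σ₁)⟫ + 0 ≤ 0 := by rw [add_zero]; exact hrate₁
    have hslope : (0 : ℝ) ≤ aR / 2 := by positivity
    have hslope' : aR / 2 < aR := by linarith only [haRpos]
    have hZR1 : ∀ s ∈ Icc σ₁ (σ₁ + τ), ‖Y s‖ ≤ 2 * R := fun s hs => hling s (hsub1 hs)
    have hphase1 := DriftClock.abs_band_bootstrap_shell (γ := γ) (P' := P') hV1 (κb := κb) (a₀ := aR) (R₁ := R₁) (R₂ := 2 * R) (h := h)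
      (t₀ := σ₁) (t₁ := σ₁ + τ) (m₀ := 0) (k := aR / 2) (le_add_of_nonneg_right hτpos.le) le_rfl hslope hslope' hmk.le hfarR
      (fun s hs => hYV s (hsub1 hs)) (fun s hs => hhighY s (hsub1 hs)) (fun s hs => hvortY s (hsub1 hs))
      hZR1 hYσ₁' hrate₁'
    have hend1 := hphase1 (σ₁ + τ) (right_mem_Icc.2 (le_add_of_nonneg_right hτpos.le))
    have hrate₂ : ⟪Y (σ₁ + τ), selfSimilarTransport γ 0 V (Y (σ₁ + τ))⟫ + κb ≤ 0 := by
      have := hend1.2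
      rwa [hmk] at this
    have hrad₂ : R₁ ≤ ‖Y (σ₁ + τ)‖ := by
      have := hend1.1; rw [hYσ₁] at this; exact le_trans hR₁Rs this
    -- ### phase 2: beyond the band forever on `[σ₁ + τ, TR]`
    have hsub2 : Icc (σ₁ + τ) TR ⊆ Icc 0 TR := fun s hs => ⟨by linarith only [hs.1, hσ₁pos.le, hτpos.le], hs.2⟩
    have hk0 : κb + 0 * (TR - (σ₁ + τ)) ≤ κb := by rw [zero_mul, add_zero]
    have hZR2 : ∀ s ∈ Icc (σ₁ + τ) TR, ‖Y s‖ ≤ 2 * R := fun s hs => hling s (hsub2 hs)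
    have hphase2 := DriftClock.abs_band_bootstrap_shell (γ := γ) (P' := P') hV1 (κb := κb) (a₀ := aR) (R₁ := R₁) (R₂ := 2 * R) (h := h)
      (t₀ := σ₁ + τ) (t₁ := TR) (m₀ := κb) (k := 0) hστTR hκb.le le_rfl haRpos hk0 hfarR
      (fun s hs => hYV s (hsub2 hs)) (fun s hs => hhighY s (hsub2 hs)) (fun s hs => hvortY s (hsub2 hs))
      hZR2 hrad₂ hrate₂
    -- ### square-root escape on `[σ₁ + τ, TR]`: `‖Y‖²` grows at rate `2κb`
    have hfast2 : ∀ s ∈ Icc (σ₁ + τ) TR, ⟪Y s, selfSimilarTransport γ 0 V (Y s)⟫ ≤ -κb := by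
      intro s hs
      have := (hphase2 s hs).2
      rw [zero_mul, add_zero] at this
      linarith only [this]
    have hgrow := DriftClock.normSq_ge_of_inflow (γ := γ) (V := V) (Z := Y) (κ := κb)
      (fun s hs => hYV s (hsub2 hs)) hfast2 TR (right_mem_Icc.2 hστTR)
    have hlingTR : ‖Y TR‖ ≤ 2 * R := hling TR (right_mem_Icc.2 hTR0)
    -- `‖Y (σ₁+τ)‖² + 2κb (TR − σ₁ − τ) > 4R²` since `TR − σ₁ − τ ≥ 1 + 3R²/κb`
    have hRs_le : Rs ≤ ‖Y (σ₁ + τ)‖ := by have := hend1.1; rwa [hYσ₁] at this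
    have hsq : 1 ≤ ‖Y (σ₁ + τ)‖ ^ 2 := one_le_pow₀ (le_trans hRs1 hRs_le)
    have htime : 1 + 3 * R ^ 2 / κb ≤ TR - (σ₁ + τ) := by linarith only [hTR_ge, hσ₁n₀]
    have hbig : 4 * R ^ 2 < ‖Y TR‖ ^ 2 := by
      have h1 : 2 * κb * (1 + 3 * R ^ 2 / κb) ≤ 2 * κb * (TR - (σ₁ + τ)) := mul_le_mul_of_nonneg_left htime (by linarith only [hκb])
      have h2' : 3 * R ^ 2 / κb * κb = 3 * R ^ 2 := div_mul_cancel₀ (3 * R ^ 2) hκb.ne'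
      have h2 : 2 * κb * (1 + 3 * R ^ 2 / κb) = 2 * κb + 6 * R ^ 2 := by linarith only [h2']
      linarith only [hgrow, h1, h2, hsq, sq_nonneg R, hκb]
    have hsmall : ‖Y TR‖ ^ 2 ≤ (2 * R) ^ 2 := pow_le_pow_left₀ (norm_nonneg _) hlingTR 2
    have h4 : (2 * R) ^ 2 = 4 * R ^ 2 := by ring
    exact lt_irrefl _ (lt_of_lt_of_le hbig (hsmall.trans h4.le))
  -- ### conclusion: measure comparison
  have hmono := measure_mono (μ := volume) hincl
  have hn₀' : volume (Sn n₀) ≤ volume (ball x₀ r) / 2 := hn₀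
  have hle : volume (ball x₀ r ∩ {y | ∀ σ ∈ Icc 0 TR, ‖Φ' (-σ) y‖ ≤ 2 * R}) ≤ volume (ball x₀ r) / 2 :=
    hmono.trans hn₀'
  have hne : volume (ball x₀ r) / 2 ≠ ∞ := ENNReal.div_ne_top hvtop.ne (by norm_num)
  have := ENNReal.toReal_mono hne hle
  rwa [ENNReal.toReal_div, ENNReal.toReal_ofNat] at this



end DriftClock

end Summit.NavierStokesRegularity.NavierStokesRegularity.Theorems.PowerGaugeEulerLiouville

end
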